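import Literature.NumberTheory.EllipticCurves.SerreOpenImageSupersingularAssemblyProofs
import Literature.NumberTheory.EllipticCurves.SerreOpenImageTameKummerProofs
import Literature.NumberTheory.EllipticCurves.SupersingularDensitySerreHoldsProofs
import HarnessLib

/-!
# Serre's open image theorem over `ℚ`: the discharge `serre_open_image_holds`

Topic `NumberTheory/EllipticCurves`.  Theorems only (nothing is defined, no named fact).  The
named fact `Literature.NumberTheory.EllipticCurves.serre_open_image` (J.-P. Serre, *Propriétés
galoisiennes des points d'ordre fini des courbes elliptiques*, Invent. Math. 15 (1972), §4.2,
Théorème 2, case `K = ℚ`: for an elliptic curve `E/ℚ` without complex multiplication the mod `ℓ`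
representation `ρ̄_{E,ℓ} : Γ_ℚ → GL₂(𝔽_ℓ)` is surjective for all large `ℓ`) is reduced in the
tree to Serre's local input (§1.11: the structure of `E[ℓ]` under the inertia groups at a good
prime `ℓ`) and the density statement used in §4.2 c) ("l'ensemble des places `v` en lesquelles
`Ẽ_v` est de hauteur `2` est de densité `0`", Serre 1968 IV-13; the tree's named fact
`WeierstrassCurve.serre_supersingular_density_zero`).  The local input is now entirely proved:
the ordinary case in `SerreOpenImageOrdinaryInertiaProofs`, the supersingular case (Prop. 12 c))
in `SerreOpenImageSupersingular{Valuation,Parameter,Inertia,Assembly}Proofs` from the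
surjectivity of the tame Kummer character, which is `SerreOpenImageTameKummerProofs`.  Hence:

* `serre_open_image_of_supersingular_density_zero` — **`serre_supersingular_density_zero →
  serre_open_image`;**
* `serre_open_image_holds` — **the discharge of the named fact**, from the tree's theorem
  `WeierstrassCurve.serre_supersingular_density_zero_holds` (`SupersingularDensitySerreHoldsProofs`:
  Serre 1981 §8 Thm. 20 Cor. 2 / Serre 1968 IV-13, proved there through the `ℓ`-adic theory and
  Faltings' theorem — the modern replacement of the input [26] cor. 1 au th. 6 of Serre's text).

(The converse implication `serre_open_image → serre_supersingular_density_zero` is the tree's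
`serre_supersingular_density_zero_of_openImage`, `SupersingularDensitySerreOpenImageProofs`,
Serre 1981 §8.)

## References

* [Serre1972] J.-P. Serre, Invent. Math. 15 (1972) 259–331: §1.3, §1.11, §2, §4.2 Théorème 2.
-/

noncomputable section

open scoped Classical NumberField
open IsDedekindDomain Field

namespace Literature.NumberTheory.EllipticCurves

open _root_.WeierstrassCurve Rat.HeightOneSpectrum

/-- **Serre 1972, §4.2, Théorème 2 over `ℚ`, from the density `0` of the supersingular primes of
non-CM curves.**  If for every elliptic curve `E/ℚ` in global minimal form without complex
multiplication the good supersingular primes have natural density `0`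
(`WeierstrassCurve.serre_supersingular_density_zero`, Serre 1968 IV-13 / 1981 §8 Thm. 20), then
for every elliptic curve `E/ℚ` without complex multiplication there is `ℓ₀` such that
`ρ̄_{E,ℓ} : Γ_ℚ → Aut(E[ℓ]) ≅ GL₂(𝔽_ℓ)` is surjective for every prime `ℓ ≥ ℓ₀` (the named fact
`serre_open_image`).  Everything else in Serre's proof — §2 (subgroups of `GL₂(𝔽_ℓ)`), §1.11
(inertia at `ℓ`: the ordinary line and, at supersingular `ℓ`, the non-split Cartan of order
`ℓ² - 1` via the tame character of level `2`), §1.3 (the tame Kummer character is onto), §4.2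
a)–c) (the quadratic character unramified outside the bad primes, Lemme 3, the density
contradiction) — is proved in the tree (`SerreOpenImage*Proofs`, `GaloisRepresentations/Serre*`).
[cite: Serre1972, §4.2 Théorème 2] -/
theorem serre_open_image_of_supersingular_density_zero (hD : serre_supersingular_density_zero) :
    serre_open_image := by
  refine serre_open_image_of_tame_kummer_surjective hD fun ℓ _ hℓ2 𝔓 hmem π ζ hπ hζ ↦ ?_
  have hp : ℓ.Prime := Fact.out
  obtain ⟨v, hv⟩ : ∃ v : HeightOneSpectrum (𝓞 ℚ), (primesEquiv v : ℕ) = ℓ :=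
    ⟨primesEquiv.symm ⟨ℓ, hp⟩, by rw [Equiv.apply_symm_apply]⟩
  obtain ⟨𝔓₀, hmem₀, h𝔓₀⟩ := exists_ideal_placeOver ℓ hv
  have h𝔓 : 𝔓 = 𝔓₀ := by
    ext x
    exact (hmem x).trans (hmem₀ x).symm
  subst h𝔓
  have hm : 0 < ℓ ^ 2 - 1 := by
    have : 4 ≤ ℓ ^ 2 := by nlinarith [hp.two_le]
    omega
  exact exists_mem_inertia_smul_eq_mul_of_pow_eq ℓ hm hv h𝔓₀ hπ hζ

/-- **Serre's open image theorem over `ℚ` (Serre 1972, §4.2, Théorème 2; the named fact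
`serre_open_image`): for every elliptic curve `E/ℚ` without complex multiplication there is `ℓ₀`
such that `ρ̄_{E,ℓ} : Gal(ℚ̄/ℚ) → GL₂(𝔽_ℓ)` is surjective for every prime `ℓ ≥ ℓ₀`.**  The density
input of §4.2 c) is the tree's theorem `WeierstrassCurve.serre_supersingular_density_zero_holds`;
the rest is `serre_open_image_of_supersingular_density_zero`.
[cite: Serre1972, §4.2 Théorème 2] -/
theorem serre_open_image_holds : serre_open_image :=
  serre_open_image_of_supersingular_density_zero serre_supersingular_density_zero_holds

end Literature.NumberTheory.EllipticCurves
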